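import Summits.KontsevichZagierPeriods.KontsevichZagierPeriods.Theorems.RootDecompZetaThreeFrontierWordFacesThreeP1

/-!
# Route A‴ — item 32433, line `gz_ladder`: the four faces of `Δ₃` cancel, part 2/4 (lens-1 g11 §22d–§22e)

Landing of the decomp-kz lens-1 generation-11 node (HOME/decomp-kz-lens-1/g11/WordLayer.lean §22, critic decomp-kz-crit-1 g3
CLEARED 2026-08-30T13:32:36Z: farm rc 0 / 0 warn / 0 sorry, axioms standard on `…GZLadder.stub_three_wlog`), in the form of the
lens's self-contained module `s22_scratch_WordMovesNamespace.lean` (sha256 453fc31fbca24adc…, imports ONLY the landed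
`…Theorems.RootDecompZetaThreeFrontierWordMoves`), split mechanically into ≤ 400-line parts by the census seat
(decomp-kz-census-1 g8).  Mathematics unchanged.  Part 2 = the three vertex involutions `τ₁₂`, `τ₀₁`, `σ₃` of `Δ₃` with their
integrability transports, the genus-zero integrand `gzf3` and the substitutions `s12P`, `s01P`, `duP3` on polynomials.
-/

noncomputable section

set_option linter.dupNamespace false

open Set MeasureTheory MvPolynomial
open Literature.NumberTheory.Transcendental
open Literature.ModelTheory.ExponentialFields (IsSemialgebraic)

namespace Summit.KontsevichZagierPeriods.KontsevichZagierPeriods.Theorems.RootDecompZetaThreeFrontierWordMoves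

section NecessityThree

/-- the coordinate projections of `ℝ³` -/
abbrev Pj3 (i : Fin 3) : (Fin 3 → ℝ) →L[ℝ] ℝ := ContinuousLinearMap.proj (R := ℝ) (φ := fun _ : Fin 3 => ℝ) i

/-- the involution `τ₁₂(t) = (t₀, t₁, t₁ - t₂)` of `Δ₃` (transposition of the vertices `(1,1,0)`, `(1,1,1)`; it exchanges the faces
`t₂ = 0` and `t₁ = t₂`) -/
def s12 (z : Fin 3 → ℝ) : Fin 3 → ℝ := ![z 0, z 1, z 1 - z 2]
/-- `τ₁₂` as a continuous linear map -/
def s12L : (Fin 3 → ℝ) →L[ℝ] (Fin 3 → ℝ) := ContinuousLinearMap.pi ![Pj3 0, Pj3 1, Pj3 1 - Pj3 2]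

/-- Auxiliary step `s12_zero`. [bookkeeping] -/
theorem s12_zero (z : Fin 3 → ℝ) : s12 z 0 = z 0 := by simp [s12]
/-- Auxiliary step `s12_one`. [bookkeeping] -/
theorem s12_one (z : Fin 3 → ℝ) : s12 z 1 = z 1 := by simp [s12]
/-- Auxiliary step `s12_two`. [bookkeeping] -/
theorem s12_two (z : Fin 3 → ℝ) : s12 z 2 = z 1 - z 2 := by simp [s12]

/-- Auxiliary step `s12_eq_L`. [bookkeeping] -/
theorem s12_eq_L (z : Fin 3 → ℝ) : s12 z = s12L z := by
  funext i
  fin_cases i <;> simp [s12, s12L]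

/-- Auxiliary step `s12_s12`. [bookkeeping] -/
theorem s12_s12 (z : Fin 3 → ℝ) : s12 (s12 z) = z := by
  funext i
  fin_cases i <;> simp [s12_zero, s12_one, s12_two]

/-- Auxiliary step `s12L_s12L`. [bookkeeping] -/
theorem s12L_s12L (w : Fin 3 → ℝ) : s12L (s12L w) = w := by
  rw [← s12_eq_L, ← s12_eq_L, s12_s12]

/-- Auxiliary step `hasFDerivAt_s12`. [bookkeeping] -/
theorem hasFDerivAt_s12 (x : Fin 3 → ℝ) : HasFDerivAt s12 s12L x := by
  have e : s12 = fun z => s12L z := funext s12_eq_L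
  rw [e]
  exact s12L.hasFDerivAt

/-- Membership in `simplex_three_s12`, unfolded. [bookkeeping] -/
theorem mem_simplex_three_s12 {z : Fin 3 → ℝ} (hz : z ∈ KZ.openOrderedSimplex 3) : s12 z ∈ KZ.openOrderedSimplex 3 := by
  rw [mem_simplex_three_iff] at hz ⊢
  rw [s12_zero, s12_one, s12_two]
  obtain ⟨h2, h21, h10, h0⟩ := hz
  exact ⟨by linarith, by linarith, h10, h0⟩

/-- `F` integrable on `Δ₃` ⟹ `F ∘ τ₁₂` integrable on `Δ₃` -/
theorem integrableOn_comp_s12 {F : (Fin 3 → ℝ) → ℝ} (hF : IntegrableOn F (KZ.openOrderedSimplex 3)) :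
    IntegrableOn (fun z => F (s12 z)) (KZ.openOrderedSimplex 3) :=
  integrableOn_comp_invol3 hasFDerivAt_s12 (abs_det_of_invol s12L_s12L) s12_s12 (fun _ hz => mem_simplex_three_s12 hz) hF

/-- the involution `τ₀₁(t) = (t₀, t₀ - t₂, t₀ - t₁)` of `Δ₃` (transposition of the vertices `(1,0,0)`, `(1,1,1)`; it exchanges the
faces `t₂ = 0` and `t₀ = t₁`) -/
def s01 (z : Fin 3 → ℝ) : Fin 3 → ℝ := ![z 0, z 0 - z 2, z 0 - z 1]
/-- `τ₀₁` as a continuous linear map -/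
def s01L : (Fin 3 → ℝ) →L[ℝ] (Fin 3 → ℝ) := ContinuousLinearMap.pi ![Pj3 0, Pj3 0 - Pj3 2, Pj3 0 - Pj3 1]

/-- Auxiliary step `s01_zero`. [bookkeeping] -/
theorem s01_zero (z : Fin 3 → ℝ) : s01 z 0 = z 0 := by simp [s01]
/-- Auxiliary step `s01_one`. [bookkeeping] -/
theorem s01_one (z : Fin 3 → ℝ) : s01 z 1 = z 0 - z 2 := by simp [s01]
/-- Auxiliary step `s01_two`. [bookkeeping] -/
theorem s01_two (z : Fin 3 → ℝ) : s01 z 2 = z 0 - z 1 := by simp [s01]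

/-- Auxiliary step `s01_eq_L`. [bookkeeping] -/
theorem s01_eq_L (z : Fin 3 → ℝ) : s01 z = s01L z := by
  funext i
  fin_cases i <;> simp [s01, s01L]

/-- Auxiliary step `s01_s01`. [bookkeeping] -/
theorem s01_s01 (z : Fin 3 → ℝ) : s01 (s01 z) = z := by
  funext i
  fin_cases i <;> simp [s01_zero, s01_one, s01_two]

/-- Auxiliary step `s01L_s01L`. [bookkeeping] -/
theorem s01L_s01L (w : Fin 3 → ℝ) : s01L (s01L w) = w := by
  rw [← s01_eq_L, ← s01_eq_L, s01_s01]

/-- Auxiliary step `hasFDerivAt_s01`. [bookkeeping] -/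
theorem hasFDerivAt_s01 (x : Fin 3 → ℝ) : HasFDerivAt s01 s01L x := by
  have e : s01 = fun z => s01L z := funext s01_eq_L
  rw [e]
  exact s01L.hasFDerivAt

/-- Membership in `simplex_three_s01`, unfolded. [bookkeeping] -/
theorem mem_simplex_three_s01 {z : Fin 3 → ℝ} (hz : z ∈ KZ.openOrderedSimplex 3) : s01 z ∈ KZ.openOrderedSimplex 3 := by
  rw [mem_simplex_three_iff] at hz ⊢
  rw [s01_zero, s01_one, s01_two]
  obtain ⟨h2, h21, h10, h0⟩ := hz
  exact ⟨by linarith, by linarith, by linarith, h0⟩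

/-- `F` integrable on `Δ₃` ⟹ `F ∘ τ₀₁` integrable on `Δ₃` -/
theorem integrableOn_comp_s01 {F : (Fin 3 → ℝ) → ℝ} (hF : IntegrableOn F (KZ.openOrderedSimplex 3)) :
    IntegrableOn (fun z => F (s01 z)) (KZ.openOrderedSimplex 3) :=
  integrableOn_comp_invol3 hasFDerivAt_s01 (abs_det_of_invol s01L_s01L) s01_s01 (fun _ hz => mem_simplex_three_s01 hz) hF

/-- Auxiliary step `hasFDerivAt_duΦ`. [bookkeeping] -/
theorem hasFDerivAt_duΦ (x : Fin 3 → ℝ) : HasFDerivAt duΦ duL x := by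
  have h : HasFDerivAt (fun z : Fin 3 → ℝ => (fun _ => (1 : ℝ)) + duL z) duL x := (duL.hasFDerivAt).const_add _
  have e : duΦ = fun z : Fin 3 → ℝ => (fun _ => (1 : ℝ)) + duL z := funext duΦ_eq
  rw [e]
  exact h

/-- `F` integrable on `Δ₃` ⟹ `F ∘ σ₃` integrable on `Δ₃` (the duality involution `σ₃(t) = (1-t₂, 1-t₁, 1-t₀)`) -/
theorem integrableOn_comp_duΦ {F : (Fin 3 → ℝ) → ℝ} (hF : IntegrableOn F (KZ.openOrderedSimplex 3)) :
    IntegrableOn (fun z => F (duΦ z)) (KZ.openOrderedSimplex 3) :=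
  integrableOn_comp_invol3 hasFDerivAt_duΦ abs_det_duL duΦ_duΦ (fun _ hz => mem_simplex_three_duΦ hz) hF

/-! ### 22e  The genus-zero integrand of dimension 3 and the three substitutions on polynomials -/

/-- the genus-zero integrand of dimension `3`:
`P/(t₀^{b₀} t₁^{b₁} t₂^{b₂} (1-t₀)^{c₀} (1-t₁)^{c₁} (1-t₂)^{c₂} (t₀-t₁)^{a₀₁} (t₀-t₂)^{a₀₂} (t₁-t₂)^{a₁₂})` -/
def gzf3 (p : MvPolynomial (Fin 3) ℚ) (b₀ b₁ b₂ c₀ c₁ c₂ a₀₁ a₀₂ a₁₂ : ℕ) (t : Fin 3 → ℝ) : ℝ :=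
  MvPolynomial.aeval t p / (t 0 ^ b₀ * t 1 ^ b₁ * t 2 ^ b₂ * (1 - t 0) ^ c₀ * (1 - t 1) ^ c₁ * (1 - t 2) ^ c₂ *
    (t 0 - t 1) ^ a₀₁ * (t 0 - t 2) ^ a₀₂ * (t 1 - t 2) ^ a₁₂)

/-- Auxiliary step `gz3_denoms_pos`. [bookkeeping] -/
theorem gz3_denoms_pos {t : Fin 3 → ℝ} (ht : t ∈ KZ.openOrderedSimplex 3) :
    0 < t 0 ∧ 0 < t 1 ∧ 0 < t 2 ∧ 0 < 1 - t 0 ∧ 0 < 1 - t 1 ∧ 0 < 1 - t 2 ∧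
      0 < t 0 - t 1 ∧ 0 < t 0 - t 2 ∧ 0 < t 1 - t 2 := by
  obtain ⟨h2, h21, h10, h0⟩ := (mem_simplex_three_iff t).1 ht
  exact ⟨by linarith, by linarith, h2, by linarith, by linarith, by linarith, by linarith, by linarith, by linarith⟩

/-- `P ↦ P(t₀, t₁, t₁ - t₂)` -/
def s12P : MvPolynomial (Fin 3) ℚ →ₐ[ℚ] MvPolynomial (Fin 3) ℚ :=
  MvPolynomial.bind₁ ![MvPolynomial.X 0, MvPolynomial.X 1, MvPolynomial.X 1 - MvPolynomial.X 2]

/-- Auxiliary step `s12P_s12P`. [bookkeeping] -/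
theorem s12P_s12P (p : MvPolynomial (Fin 3) ℚ) : s12P (s12P p) = p := by
  have h : s12P.comp s12P = AlgHom.id ℚ _ := MvPolynomial.algHom_ext fun i => by
    fin_cases i <;> simp [s12P, MvPolynomial.bind₁_X_right]
  exact AlgHom.congr_fun h p

/-- Auxiliary step `aeval_s12P`. [bookkeeping] -/
theorem aeval_s12P (p : MvPolynomial (Fin 3) ℚ) (t : Fin 3 → ℝ) :
    MvPolynomial.aeval t (s12P p) = MvPolynomial.aeval (s12 t) p := by
  have e : (fun i => MvPolynomial.aeval t
      ((![MvPolynomial.X 0, MvPolynomial.X 1, MvPolynomial.X 1 - MvPolynomial.X 2] :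
        Fin 3 → MvPolynomial (Fin 3) ℚ) i)) = s12 t := by
    funext i
    fin_cases i <;> simp [s12_zero, s12_one, s12_two]
  rw [s12P, MvPolynomial.aeval_bind₁, e]

/-- `P ↦ P(t₀, t₀ - t₂, t₀ - t₁)` -/
def s01P : MvPolynomial (Fin 3) ℚ →ₐ[ℚ] MvPolynomial (Fin 3) ℚ :=
  MvPolynomial.bind₁ ![MvPolynomial.X 0, MvPolynomial.X 0 - MvPolynomial.X 2, MvPolynomial.X 0 - MvPolynomial.X 1]

/-- Auxiliary step `s01P_s01P`. [bookkeeping] -/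
theorem s01P_s01P (p : MvPolynomial (Fin 3) ℚ) : s01P (s01P p) = p := by
  have h : s01P.comp s01P = AlgHom.id ℚ _ := MvPolynomial.algHom_ext fun i => by
    fin_cases i <;> simp [s01P, MvPolynomial.bind₁_X_right]
  exact AlgHom.congr_fun h p

/-- Auxiliary step `aeval_s01P`. [bookkeeping] -/
theorem aeval_s01P (p : MvPolynomial (Fin 3) ℚ) (t : Fin 3 → ℝ) :
    MvPolynomial.aeval t (s01P p) = MvPolynomial.aeval (s01 t) p := by
  have e : (fun i => MvPolynomial.aeval t
      ((![MvPolynomial.X 0, MvPolynomial.X 0 - MvPolynomial.X 2, MvPolynomial.X 0 - MvPolynomial.X 1] :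
        Fin 3 → MvPolynomial (Fin 3) ℚ) i)) = s01 t := by
    funext i
    fin_cases i <;> simp [s01_zero, s01_one, s01_two]
  rw [s01P, MvPolynomial.aeval_bind₁, e]

/-- `P ↦ P(1 - t₂, 1 - t₁, 1 - t₀)` -/
def duP3 : MvPolynomial (Fin 3) ℚ →ₐ[ℚ] MvPolynomial (Fin 3) ℚ :=
  MvPolynomial.bind₁ ![MvPolynomial.C 1 - MvPolynomial.X 2, MvPolynomial.C 1 - MvPolynomial.X 1,
    MvPolynomial.C 1 - MvPolynomial.X 0]

/-- Auxiliary step `duP3_duP3`. [bookkeeping] -/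
theorem duP3_duP3 (p : MvPolynomial (Fin 3) ℚ) : duP3 (duP3 p) = p := by
  have h : duP3.comp duP3 = AlgHom.id ℚ _ := MvPolynomial.algHom_ext fun i => by
    fin_cases i <;> simp [duP3, MvPolynomial.bind₁_X_right]
  exact AlgHom.congr_fun h p

/-- Auxiliary step `aeval_duP3`. [bookkeeping] -/
theorem aeval_duP3 (p : MvPolynomial (Fin 3) ℚ) (t : Fin 3 → ℝ) :
    MvPolynomial.aeval t (duP3 p) = MvPolynomial.aeval (duΦ t) p := by
  have e : (fun i => MvPolynomial.aeval t
      ((![MvPolynomial.C 1 - MvPolynomial.X 2, MvPolynomial.C 1 - MvPolynomial.X 1, MvPolynomial.C 1 - MvPolynomial.X 0] :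
        Fin 3 → MvPolynomial (Fin 3) ℚ) i)) = duΦ t := by
    funext i
    fin_cases i <;> simp [duΦ_zero, duΦ_one, duΦ_two]
  rw [duP3, MvPolynomial.aeval_bind₁, e]

end NecessityThree

end Summit.KontsevichZagierPeriods.KontsevichZagierPeriods.Theorems.RootDecompZetaThreeFrontierWordMoves
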